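import Literature.Analysis.FluidPDE.SmoothRampProfiles
import Mathlib.Analysis.SpecialFunctions.Log.Deriv
import Mathlib.Analysis.SpecialFunctions.Integrals.Basic
import HarnessLib

/-!
# The shear profile and the compensated transverse coordinate of the interpolated-shear band

Topic `Literature/Analysis/FluidPDE`. The concrete data of `PlanarInterpShearBand.lean`:

* the **shear profile** `shearProfile D x = -x/(2D) χ(x) - (1 - χ(x)) σ(x) / 2` of half-length
  `D > 0`: smooth, equal to `1/2` for `x ≤ -D`, to `-1/2` for `x ≥ D`, EXACTLY LINEAR `-x/(2D)` on
  the core `|x| ≤ D/2`, of sign `-sgn x` and modulus in `[|x|/(2D) ⊓ 1/2, 1/2]` in between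
  (`χ` a plateau, `σ` a smooth sign, both from `SmoothRampProfiles.lean`);

(the compensated coordinate `F` solving `(1 + λ' s) Fₛ - λ Fₓ = 1` — `-2D log(1 - s/(2D))` on the
core, `P(x + λ(x) s) - P(x)` with `P` a primitive of `1/λ` outside — is the subject of the sequel).

Folklore; no named facts. Infrastructure towards a discharge of `acm_compatible_blocks`
(`QuasiSelfSimilarCompatibleBlocks.lean`).

## References

* G. Alberti, G. Crippa, A. L. Mazzucato, *Exponential self-similar mixing by incompressible
  flows*, J. Amer. Math. Soc. 32 (2019), 445–490, §7 (arXiv:1605.02090).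
-/

noncomputable section

open Set Filter Topology MeasureTheory intervalIntegral
open scoped ContDiff

namespace Literature.Analysis.FluidPDE

namespace PlanarKinematics

open Literature.Analysis.FluidPDE.Gluing

/-! ## The shear profile -/

/-- The core plateau of the profile: `1` on `|x| ≤ 3D/4`, `0` on `|x| ≥ 7D/8`. [folklore] -/
def shearPlateau (D x : ℝ) : ℝ := plateau (-D) D (3 * D / 8) x

/-- The smooth sign of the profile: `0` on `|x| ≤ 9D/16`, `± 1` for `± x ≥ 5D/8`. [folklore] -/
def shearSign (D x : ℝ) : ℝ := step ((x - D / 2) / (3 * D / 16)) - step ((-x - D / 2) / (3 * D / 16))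

/-- **The shear profile of half-length `D`**: `λ(x) = -x/(2D) χ(x) - (1 - χ(x)) σ(x)/2`. [folklore] -/
def shearProfile (D x : ℝ) : ℝ :=
  -(x / (2 * D)) * shearPlateau D x - (1 - shearPlateau D x) * shearSign D x / 2

/-- Unfolding. [folklore] -/
theorem shearProfile_apply (D x : ℝ) :
    shearProfile D x = -(x / (2 * D)) * shearPlateau D x - (1 - shearPlateau D x) * shearSign D x / 2 := rfl

/-- The plateau is `1` on `|x| ≤ 3D/4`. [folklore] -/
theorem shearPlateau_eq_one {D x : ℝ} (hD : 0 < D) (hx : |x| ≤ 3 * D / 4) : shearPlateau D x = 1 := by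
  rw [abs_le] at hx
  exact plateau_of_mem (by positivity) (by linarith [hx.1]) (by linarith [hx.2])

/-- The plateau vanishes on `x ≥ 7D/8`. [folklore] -/
theorem shearPlateau_eq_zero_of_ge {D x : ℝ} (hD : 0 < D) (hx : 7 * D / 8 ≤ x) : shearPlateau D x = 0 :=
  plateau_of_ge_right (by positivity) (by linarith)

/-- The plateau vanishes on `x ≤ -7D/8`. [folklore] -/
theorem shearPlateau_eq_zero_of_le {D x : ℝ} (hD : 0 < D) (hx : x ≤ -(7 * D / 8)) : shearPlateau D x = 0 :=
  plateau_of_le_left (by positivity) (by linarith)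

/-- The plateau takes values in `[0, 1]`. [folklore] -/
theorem shearPlateau_mem_Icc (D x : ℝ) : shearPlateau D x ∈ Icc (0 : ℝ) 1 := plateau_mem_Icc _ _ _ _

/-- The plateau is smooth. [folklore] -/
theorem shearPlateau_contDiff (D : ℝ) {n : ℕ∞} : ContDiff ℝ n (shearPlateau D) := plateau_contDiff

/-- The smooth sign is `1` on `x ≥ 5D/8`. [folklore] -/
theorem shearSign_eq_one {D x : ℝ} (hD : 0 < D) (hx : 5 * D / 8 ≤ x) : shearSign D x = 1 := by
  rw [shearSign, step_of_ge, step_of_le, sub_zero]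
  · rw [div_le_iff₀ (by positivity)]; linarith
  · rw [le_div_iff₀ (by positivity)]; linarith

/-- The smooth sign is `-1` on `x ≤ -5D/8`. [folklore] -/
theorem shearSign_eq_neg_one {D x : ℝ} (hD : 0 < D) (hx : x ≤ -(5 * D / 8)) : shearSign D x = -1 := by
  rw [shearSign, step_of_le, step_of_ge, zero_sub]
  · rw [le_div_iff₀ (by positivity)]; linarith
  · rw [div_le_iff₀ (by positivity)]; linarith

/-- The smooth sign takes values in `[-1, 1]`. [folklore] -/
theorem abs_shearSign_le (D x : ℝ) : |shearSign D x| ≤ 1 := by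
  rw [shearSign, abs_le]
  constructor <;> linarith [step_nonneg ((x - D / 2) / (3 * D / 16)), step_le_one ((x - D / 2) / (3 * D / 16)),
    step_nonneg ((-x - D / 2) / (3 * D / 16)), step_le_one ((-x - D / 2) / (3 * D / 16))]

/-- The smooth sign is nonnegative on `x ≥ 0`. [folklore] -/
theorem shearSign_nonneg {D x : ℝ} (hD : 0 < D) (hx : 0 ≤ x) : 0 ≤ shearSign D x := by
  rw [shearSign, step_of_le (x := (-x - D / 2) / (3 * D / 16)), sub_zero]
  · exact step_nonneg _
  · rw [div_le_iff₀ (by positivity)]; linarith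

/-- The smooth sign is nonpositive on `x ≤ 0`. [folklore] -/
theorem shearSign_nonpos {D x : ℝ} (hD : 0 < D) (hx : x ≤ 0) : shearSign D x ≤ 0 := by
  rw [shearSign, step_of_le (x := (x - D / 2) / (3 * D / 16)), zero_sub, neg_nonpos]
  · exact step_nonneg _
  · rw [div_le_iff₀ (by positivity)]; linarith

/-- The smooth sign is smooth. [folklore] -/
theorem shearSign_contDiff (D : ℝ) {n : ℕ∞} : ContDiff ℝ n (shearSign D) :=
  (step_contDiff.comp ((contDiff_id.sub contDiff_const).div_const _)).sub
    (step_contDiff.comp ((contDiff_neg.sub contDiff_const).div_const _))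

/-- **The shear profile is smooth.** [folklore] -/
theorem shearProfile_contDiff (D : ℝ) {n : ℕ∞} : ContDiff ℝ n (shearProfile D) := by
  unfold shearProfile
  exact ((contDiff_id.div_const _).neg.mul (shearPlateau_contDiff D)).sub
    (((contDiff_const.sub (shearPlateau_contDiff D)).mul (shearSign_contDiff D)).div_const _)

/-- **The profile is exactly linear on the core**: `λ(x) = -x/(2D)` for `|x| ≤ 3D/4`. [folklore] -/
theorem shearProfile_of_abs_le {D x : ℝ} (hD : 0 < D) (hx : |x| ≤ 3 * D / 4) :
    shearProfile D x = -(x / (2 * D)) := by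
  rw [shearProfile_apply, shearPlateau_eq_one hD hx]; ring

/-- **The profile is `-1/2` beyond `D`.** [folklore] -/
theorem shearProfile_of_ge {D x : ℝ} (hD : 0 < D) (hx : D ≤ x) : shearProfile D x = -(1 / 2) := by
  rw [shearProfile_apply, shearPlateau_eq_zero_of_ge hD (by linarith), shearSign_eq_one hD (by linarith)]; ring

/-- **The profile is `1/2` before `-D`.** [folklore] -/
theorem shearProfile_of_le {D x : ℝ} (hD : 0 < D) (hx : x ≤ -D) : shearProfile D x = 1 / 2 := by
  rw [shearProfile_apply, shearPlateau_eq_zero_of_le hD (by linarith), shearSign_eq_neg_one hD (by linarith)]; ring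

/-- The profile vanishes at the centre. [folklore] -/
theorem shearProfile_zero {D : ℝ} (hD : 0 < D) : shearProfile D 0 = 0 := by
  rw [shearProfile_of_abs_le hD (by rw [abs_zero]; positivity)]; simp

/-- **Upper bound on the right**: for `0 ≤ x`, `λ(x) ≤ -min(x/(2D), 1/2)`; in particular
`λ < 0` for `x > 0`. [folklore] -/
theorem shearProfile_le_of_nonneg {D x : ℝ} (hD : 0 < D) (hx : 0 ≤ x) :
    shearProfile D x ≤ -min (x / (2 * D)) (1 / 2) := by
  rcases le_or_gt x (5 * D / 8) with h | h
  · -- on `[0, 5D/8]` the plateau is `1`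
    rw [shearProfile_of_abs_le hD (by rw [abs_of_nonneg hx]; linarith)]
    linarith [min_le_left (x / (2 * D)) (1 / 2)]
  · -- beyond `5D/8` the sign is `1` and the value is a convex combination of `-x/(2D)` and `-1/2`
    rw [shearProfile_apply, shearSign_eq_one hD h.le]
    obtain ⟨h0, h1⟩ := shearPlateau_mem_Icc D x
    set χ := shearPlateau D x
    have hm1 := min_le_left (x / (2 * D)) (1 / 2)
    have hm2 := min_le_right (x / (2 * D)) (1 / 2)
    nlinarith

/-- **Lower bound on the right**: for `0 ≤ x`, `-max(x/(2D), 1/2) ≤ λ(x)`; with the upper bound,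
`|λ| ≤ 1/2` on `[0, D]` and beyond. [folklore] -/
theorem neg_le_shearProfile_of_nonneg {D x : ℝ} (hD : 0 < D) (hx : 0 ≤ x) :
    -max (x / (2 * D)) (1 / 2) ≤ shearProfile D x := by
  rcases le_or_gt x (5 * D / 8) with h | h
  · rw [shearProfile_of_abs_le hD (by rw [abs_of_nonneg hx]; linarith)]
    linarith [le_max_left (x / (2 * D)) (1 / 2)]
  · rw [shearProfile_apply, shearSign_eq_one hD h.le]
    obtain ⟨h0, h1⟩ := shearPlateau_mem_Icc D x
    set χ := shearPlateau D x
    have hm1 := le_max_left (x / (2 * D)) (1 / 2)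
    have hm2 := le_max_right (x / (2 * D)) (1 / 2)
    nlinarith

/-- **The profile is odd.** [folklore] -/
theorem shearProfile_neg {D : ℝ} (x : ℝ) : shearProfile D (-x) = -shearProfile D x := by
  have hχ : shearPlateau D (-x) = shearPlateau D x := by
    simp only [shearPlateau, plateau_apply]
    rw [mul_comm]
    congr 2 <;> ring
  have hσ : shearSign D (-x) = -shearSign D x := by
    simp only [shearSign, neg_neg]; ring
  rw [shearProfile_apply, shearProfile_apply, hχ, hσ]; ring

/-- **The profile does not vanish off the centre** and has the sign of `-x`: for `0 < x`,
`λ(x) < 0`. [folklore] -/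
theorem shearProfile_neg_of_pos {D x : ℝ} (hD : 0 < D) (hx : 0 < x) : shearProfile D x < 0 := by
  have h := shearProfile_le_of_nonneg hD hx.le
  have : 0 < min (x / (2 * D)) (1 / 2) := lt_min (by positivity) (by norm_num)
  linarith

/-- For `x < 0`, `λ(x) > 0`. [folklore] -/
theorem shearProfile_pos_of_neg {D x : ℝ} (hD : 0 < D) (hx : x < 0) : 0 < shearProfile D x := by
  have h := shearProfile_neg_of_pos hD (neg_pos.mpr hx)
  rw [shearProfile_neg] at h
  linarith

/-- `λ(x) ≠ 0` for `x ≠ 0`. [folklore] -/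
theorem shearProfile_ne_zero {D x : ℝ} (hD : 0 < D) (hx : x ≠ 0) : shearProfile D x ≠ 0 := by
  rcases lt_or_gt_of_ne hx with h | h
  · exact (shearProfile_pos_of_neg hD h).ne'
  · exact (shearProfile_neg_of_pos hD h).ne

/-- **`|λ| ≤ 1/2` everywhere.** [folklore] -/
theorem abs_shearProfile_le {D : ℝ} (hD : 0 < D) (x : ℝ) : |shearProfile D x| ≤ 1 / 2 := by
  suffices h : ∀ y, 0 ≤ y → |shearProfile D y| ≤ 1 / 2 by
    rcases le_or_gt 0 x with hx | hx
    · exact h x hx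
    · have := h (-x) (by linarith)
      rwa [shearProfile_neg, abs_neg] at this
  intro y hy
  have h1 := shearProfile_le_of_nonneg hD hy
  have h2 := neg_le_shearProfile_of_nonneg hD hy
  rw [abs_le]
  constructor
  · rcases le_or_gt (y / (2 * D)) (1 / 2) with h | h
    · rw [max_eq_right h] at h2; linarith
    · -- here `y ≥ D`, and the profile is `-1/2`
      have hyD : D ≤ y := by
        rw [lt_div_iff₀ (by positivity)] at h; linarith
      rw [shearProfile_of_ge hD hyD]
  · have : 0 ≤ min (y / (2 * D)) (1 / 2) := le_min (by positivity) (by norm_num)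
    linarith

/-- **On the right blend the modulus is at least `|x|/(2D) ⊓ 1/2`**: for `0 ≤ x`,
`min(x/(2D), 1/2) ≤ -λ(x)`. [folklore] -/
theorem min_le_neg_shearProfile {D x : ℝ} (hD : 0 < D) (hx : 0 ≤ x) :
    min (x / (2 * D)) (1 / 2) ≤ -shearProfile D x := by
  linarith [shearProfile_le_of_nonneg hD hx]

/-! ## The reciprocal profile and its primitive off the centre -/

/-- The reciprocal `1/λ` of the profile (its value at the centre is irrelevant). [folklore] -/
def shearRecip (D x : ℝ) : ℝ := (shearProfile D x)⁻¹

/-- Unfolding. [folklore] -/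
theorem shearRecip_apply (D x : ℝ) : shearRecip D x = (shearProfile D x)⁻¹ := rfl

/-- `1/λ` is smooth off the centre. [folklore] -/
theorem shearRecip_contDiffOn {D : ℝ} (hD : 0 < D) {n : ℕ∞} :
    ContDiffOn ℝ n (shearRecip D) {x | x ≠ 0} := fun _ hx =>
  ((shearProfile_contDiff D (n := n)).contDiffAt.inv (shearProfile_ne_zero hD hx)).contDiffWithinAt

/-- `1/λ` is continuous off the centre. [folklore] -/
theorem shearRecip_continuousOn {D : ℝ} (hD : 0 < D) : ContinuousOn (shearRecip D) {x | x ≠ 0} :=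
  (shearRecip_contDiffOn hD (n := 0)).continuousOn

/-- On the core (off the centre) `1/λ = -2D/x`. [folklore] -/
theorem shearRecip_of_abs_le {D x : ℝ} (hD : 0 < D) (hx : |x| ≤ 3 * D / 4) :
    shearRecip D x = -(2 * D) * x⁻¹ := by
  rw [shearRecip_apply, shearProfile_of_abs_le hD hx]
  rcases eq_or_ne x 0 with h | h
  · simp [h]
  · field_simp

/-- `1/λ` is interval integrable on intervals not containing the centre (positive side).
[folklore] -/
theorem shearRecip_intervalIntegrable_pos {D a b : ℝ} (hD : 0 < D) (ha : 0 < a) (hb : 0 < b) :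
    IntervalIntegrable (shearRecip D) MeasureTheory.volume a b := by
  refine ContinuousOn.intervalIntegrable ((shearRecip_continuousOn hD).mono fun x hx => ?_)
  have h1 : min a b ≤ x := by
    rcases Set.mem_uIcc.mp hx with h | h
    · exact (min_le_left a b).trans h.1
    · exact (min_le_right a b).trans h.1
  exact (lt_of_lt_of_le (lt_min ha hb) h1).ne'

/-- `1/λ` is interval integrable on intervals not containing the centre (negative side).
[folklore] -/
theorem shearRecip_intervalIntegrable_neg {D a b : ℝ} (hD : 0 < D) (ha : a < 0) (hb : b < 0) :
    IntervalIntegrable (shearRecip D) MeasureTheory.volume a b := by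
  refine ContinuousOn.intervalIntegrable ((shearRecip_continuousOn hD).mono fun x hx => ?_)
  have h1 : x ≤ max a b := by
    rcases Set.mem_uIcc.mp hx with h | h
    · exact h.2.trans (le_max_right a b)
    · exact h.2.trans (le_max_left a b)
  exact (lt_of_le_of_lt h1 (max_lt ha hb)).ne

/-- **A primitive of `1/λ` on each side of the centre**: base point `D` on the right, `-D` on the
left. [folklore] -/
def shearPrim (D x : ℝ) : ℝ :=
  if 0 < x then ∫ s in D..x, shearRecip D s else ∫ s in (-D)..x, shearRecip D s

/-- The primitive on the right. [folklore] -/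
theorem shearPrim_of_pos {D x : ℝ} (hx : 0 < x) : shearPrim D x = ∫ s in D..x, shearRecip D s := if_pos hx

/-- The primitive on the left. [folklore] -/
theorem shearPrim_of_neg {D x : ℝ} (hx : x < 0) : shearPrim D x = ∫ s in (-D)..x, shearRecip D s :=
  if_neg (not_lt.mpr hx.le)

/-- **Differences of the primitive are integrals of `1/λ`** (positive side). [folklore] -/
theorem shearPrim_sub_of_pos {D x y : ℝ} (hD : 0 < D) (hx : 0 < x) (hy : 0 < y) :
    shearPrim D y - shearPrim D x = ∫ s in x..y, shearRecip D s := by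
  rw [shearPrim_of_pos hx, shearPrim_of_pos hy]
  exact intervalIntegral.integral_interval_sub_left (shearRecip_intervalIntegrable_pos hD hD hy)
    (shearRecip_intervalIntegrable_pos hD hD hx)

/-- **Differences of the primitive are integrals of `1/λ`** (negative side). [folklore] -/
theorem shearPrim_sub_of_neg {D x y : ℝ} (hD : 0 < D) (hx : x < 0) (hy : y < 0) :
    shearPrim D y - shearPrim D x = ∫ s in x..y, shearRecip D s := by
  rw [shearPrim_of_neg hx, shearPrim_of_neg hy]
  exact intervalIntegral.integral_interval_sub_left (shearRecip_intervalIntegrable_neg hD (by linarith) hy)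
    (shearRecip_intervalIntegrable_neg hD (by linarith) hx)

/-- **The primitive has derivative `1/λ` off the centre.** [folklore] -/
theorem hasDerivAt_shearPrim {D x : ℝ} (hD : 0 < D) (hx : x ≠ 0) : HasDerivAt (shearPrim D) (shearRecip D x) x := by
  have hmeas : StronglyMeasurableAtFilter (shearRecip D) (nhds x) MeasureTheory.volume :=
    (shearRecip_continuousOn hD).stronglyMeasurableAtFilter isOpen_ne x hx
  have hcont : ContinuousAt (shearRecip D) x := (shearRecip_continuousOn hD).continuousAt (isOpen_ne.mem_nhds hx)
  rcases lt_or_gt_of_ne hx with h | h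
  · have hF : HasDerivAt (fun u => ∫ s in (-D)..u, shearRecip D s) (shearRecip D x) x :=
      intervalIntegral.integral_hasDerivAt_right (shearRecip_intervalIntegrable_neg hD (by linarith) h) hmeas hcont
    refine hF.congr_of_eventuallyEq ?_
    filter_upwards [Iio_mem_nhds h] with u hu using shearPrim_of_neg hu
  · have hF : HasDerivAt (fun u => ∫ s in D..u, shearRecip D s) (shearRecip D x) x :=
      intervalIntegral.integral_hasDerivAt_right (shearRecip_intervalIntegrable_pos hD hD h) hmeas hcont
    refine hF.congr_of_eventuallyEq ?_
    filter_upwards [Ioi_mem_nhds h] with u hu using shearPrim_of_pos hu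

/-- **The primitive is smooth off the centre.** [folklore] -/
theorem shearPrim_contDiffOn {D : ℝ} (hD : 0 < D) : ContDiffOn ℝ ∞ (shearPrim D) {x | x ≠ 0} := by
  rw [contDiffOn_infty_iff_deriv_of_isOpen isOpen_ne]
  refine ⟨fun x hx => (hasDerivAt_shearPrim hD hx).differentiableAt.differentiableWithinAt, ?_⟩
  exact (shearRecip_contDiffOn hD).congr fun x hx => (hasDerivAt_shearPrim hD hx).deriv

/-- **On the core the primitive is a logarithm**: for `x, y` of the same sign in the core,
`P(y) - P(x) = -2D log(y/x)`. [folklore] -/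
theorem shearPrim_sub_of_core {D x y : ℝ} (hD : 0 < D) (hx : |x| ≤ 3 * D / 4) (hy : |y| ≤ 3 * D / 4)
    (hxy : 0 < x * y) : shearPrim D y - shearPrim D x = -(2 * D) * Real.log (y / x) := by
  have hx0 : x ≠ 0 := by rintro rfl; simp at hxy
  have hy0 : y ≠ 0 := by rintro rfl; simp at hxy
  -- `0 ∉ [x, y]`
  have h0 : (0 : ℝ) ∉ Set.uIcc x y := by
    intro h
    rcases Set.mem_uIcc.mp h with ⟨h1, h2⟩ | ⟨h1, h2⟩
    · nlinarith
    · nlinarith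
  -- the integrand is `-2D/s` on `[x, y]`, which lies in the core
  have hcong : ∫ s in x..y, shearRecip D s = ∫ s in x..y, -(2 * D) * s⁻¹ := by
    refine intervalIntegral.integral_congr fun s hs => ?_
    have hs' : |s| ≤ 3 * D / 4 := by
      rcases Set.mem_uIcc.mp hs with ⟨h1, h2⟩ | ⟨h1, h2⟩
      · rw [abs_le] at hx hy ⊢; constructor <;> linarith [hx.1, hy.2]
      · rw [abs_le] at hx hy ⊢; constructor <;> linarith [hy.1, hx.2]
    exact shearRecip_of_abs_le hD hs'
  have hsub : shearPrim D y - shearPrim D x = ∫ s in x..y, shearRecip D s := by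
    rcases lt_or_gt_of_ne hx0 with h | h
    · exact shearPrim_sub_of_neg hD h (by nlinarith)
    · exact shearPrim_sub_of_pos hD h (by nlinarith)
  rw [hsub, hcong, intervalIntegral.integral_const_mul, integral_inv h0]

/-! ## The compensated transverse coordinate -/

/-- **The compensated transverse coordinate** `F(x, s)`: `-2D log(1 - s/(2D))` on the core
`|x| < D/2`, `P(x + λ(x) s) - P(x)` outside; the two agree on `D/4 ≤ |x| ≤ 3D/5`
(`compCoord_eq_prim`), so `F` is smooth on `|s| < D/2` and solves `(1 + λ' s) Fₛ - λ Fₓ = 1`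
there. [folklore] -/
def compCoord (D x s : ℝ) : ℝ :=
  if |x| < D / 2 then -(2 * D) * Real.log (1 - s / (2 * D))
  else shearPrim D (x + shearProfile D x * s) - shearPrim D x

/-- The outer formula of the compensated coordinate. [folklore] -/
def compCoordOut (D : ℝ) (p : ℝ × ℝ) : ℝ := shearPrim D (p.1 + shearProfile D p.1 * p.2) - shearPrim D p.1

/-- The core formula of the compensated coordinate. [folklore] -/
def compCoordCore (D : ℝ) (p : ℝ × ℝ) : ℝ := -(2 * D) * Real.log (1 - p.2 / (2 * D))

/-- Unfolding on the core. [folklore] -/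
theorem compCoord_of_core {D x s : ℝ} (hx : |x| < D / 2) : compCoord D x s = compCoordCore D (x, s) := if_pos hx

/-- Unfolding off the core. [folklore] -/
theorem compCoord_of_not_core {D x s : ℝ} (hx : ¬ |x| < D / 2) : compCoord D x s = compCoordOut D (x, s) := if_neg hx

/-- **The two formulas agree on the overlap**: for `D/4 ≤ |x| ≤ 3D/5` and `|s| ≤ D/2`,
`P(x + λ(x) s) - P(x) = -2D log(1 - s/(2D))` (the integral of `-2D/r` over `[x, x(1 - s/2D)]`).
[folklore] -/
theorem compCoordOut_eq_core {D x s : ℝ} (hD : 0 < D) (hx1 : D / 4 ≤ |x|) (hx2 : |x| ≤ 3 * D / 5)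
    (hs : |s| ≤ D / 2) : compCoordOut D (x, s) = compCoordCore D (x, s) := by
  simp only [compCoordOut, compCoordCore]
  have hx0 : x ≠ 0 := by
    intro h; rw [h, abs_zero] at hx1; linarith
  have hlam : shearProfile D x = -(x / (2 * D)) := shearProfile_of_abs_le hD (by linarith)
  have hw : x + shearProfile D x * s = x * (1 - s / (2 * D)) := by rw [hlam]; field_simp; ring
  have hfac : 0 < 1 - s / (2 * D) := by
    rw [abs_le] at hs
    have : s / (2 * D) ≤ 1 / 4 := by rw [div_le_iff₀ (by positivity)]; linarith
    linarith
  have hfac' : 1 - s / (2 * D) ≤ 5 / 4 := by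
    rw [abs_le] at hs
    have : -(1 / 4) ≤ s / (2 * D) := by rw [le_div_iff₀ (by positivity)]; linarith
    linarith
  rw [hw]
  have habs : |x * (1 - s / (2 * D))| ≤ 3 * D / 4 := by
    rw [abs_mul, abs_of_pos hfac]
    calc |x| * (1 - s / (2 * D)) ≤ 3 * D / 5 * (5 / 4) := by gcongr
      _ = 3 * D / 4 := by ring
  have hxx : 0 < x * (x * (1 - s / (2 * D))) := by
    rw [← mul_assoc]
    exact mul_pos (lt_of_le_of_ne (mul_self_nonneg x) (mul_self_ne_zero.mpr hx0).symm) hfac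
  rw [shearPrim_sub_of_core hD (by linarith) habs hxx]
  congr 2
  field_simp

/-- On the overlap the compensated coordinate is given by the outer formula. [folklore] -/
theorem compCoord_eq_out {D x s : ℝ} (hD : 0 < D) (hx : D / 4 < |x|) (hs : |s| < D / 2) :
    compCoord D x s = compCoordOut D (x, s) := by
  by_cases h : |x| < D / 2
  · rw [compCoord_of_core h, ← compCoordOut_eq_core hD hx.le (by linarith) hs.le]
  · exact compCoord_of_not_core h

/-- **The coordinate vanishes on the graph**: `F(x, 0) = 0`. [folklore] -/
theorem compCoord_zero_right (D x : ℝ) : compCoord D x 0 = 0 := by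
  by_cases h : |x| < D / 2
  · rw [compCoord_of_core h, compCoordCore]; simp
  · rw [compCoord_of_not_core h, compCoordOut]; simp

/-! ### Smoothness on the band `|s| < D/2` -/

/-- The domain of the compensated coordinate. [folklore] -/
def compDom (D : ℝ) : Set (ℝ × ℝ) := {p | |p.2| < D / 2}

/-- The domain is open. [folklore] -/
theorem isOpen_compDom (D : ℝ) : IsOpen (compDom D) :=
  isOpen_lt (continuous_abs.comp continuous_snd) continuous_const

/-- The core formula is smooth on `s < 2D`. [folklore] -/
theorem compCoordCore_contDiffAt {D : ℝ} (hD : 0 < D) {p : ℝ × ℝ} (hp : p.2 < 2 * D) {n : WithTop ℕ∞} :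
    ContDiffAt ℝ n (compCoordCore D) p := by
  have h1 : ContDiffAt ℝ n (fun q : ℝ × ℝ => 1 - q.2 / (2 * D)) p :=
    (contDiffAt_const.sub (contDiffAt_snd.div_const _))
  have hpos : 1 - p.2 / (2 * D) ≠ 0 := by
    have : p.2 / (2 * D) < 1 := by rw [div_lt_one (by positivity)]; linarith
    linarith
  exact contDiffAt_const.mul (h1.log hpos)

/-- The outer formula is smooth where `x ≠ 0` and `x + λ(x) s ≠ 0`. [folklore] -/
theorem compCoordOut_contDiffAt {D : ℝ} (hD : 0 < D) {p : ℝ × ℝ} (h0 : p.1 ≠ 0)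
    (hw : p.1 + shearProfile D p.1 * p.2 ≠ 0) {n : ℕ∞} : ContDiffAt ℝ n (compCoordOut D) p := by
  have hP : ∀ y : ℝ, y ≠ 0 → ContDiffAt ℝ n (shearPrim D) y := fun y hy =>
    ((shearPrim_contDiffOn hD).of_le (by exact_mod_cast le_top)).contDiffAt (isOpen_ne.mem_nhds hy)
  have hwf : ContDiffAt ℝ n (fun q : ℝ × ℝ => q.1 + shearProfile D q.1 * q.2) p :=
    contDiffAt_fst.add (((shearProfile_contDiff D).contDiffAt.comp p contDiffAt_fst).mul contDiffAt_snd)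
  exact ((hP _ hw).comp p hwf).sub ((hP _ h0).comp p contDiffAt_fst)

/-- Off the core quarter the sheared point does not reach the centre: `D/4 < |x|`, `|s| < D/2`
give `x + λ(x) s ≠ 0`. [folklore] -/
theorem abscissa_ne_zero {D x s : ℝ} (hD : 0 < D) (hx : D / 4 < |x|) (hs : |s| < D / 2) :
    x + shearProfile D x * s ≠ 0 := by
  intro h
  have h1 : |shearProfile D x * s| ≤ 1 / 2 * (D / 2) := by
    rw [abs_mul]
    exact mul_le_mul (abs_shearProfile_le hD x) hs.le (abs_nonneg s) (by norm_num)
  have hx' : x = -(shearProfile D x * s) := by linarith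
  have h2 : |x| = |shearProfile D x * s| := by
    conv_lhs => rw [hx']
    rw [abs_neg]
  linarith

/-- **The compensated coordinate is smooth on the band `|s| < D/2`.** [folklore] -/
theorem compCoord_contDiffAt {D : ℝ} (hD : 0 < D) {p : ℝ × ℝ} (hp : p ∈ compDom D) {n : ℕ∞} :
    ContDiffAt ℝ n (fun q : ℝ × ℝ => compCoord D q.1 q.2) p := by
  have hs : |p.2| < D / 2 := hp
  by_cases hcore : |p.1| < D / 2
  · -- near `p` the coordinate is the core formula
    have hev : (fun q : ℝ × ℝ => compCoord D q.1 q.2) =ᶠ[𝓝 p] compCoordCore D := by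
      have ho : IsOpen {q : ℝ × ℝ | |q.1| < D / 2} := isOpen_lt (continuous_abs.comp continuous_fst) continuous_const
      filter_upwards [ho.mem_nhds hcore] with q hq using compCoord_of_core hq
    refine (compCoordCore_contDiffAt hD ?_).congr_of_eventuallyEq hev
    rw [abs_lt] at hs; linarith
  · -- near `p` the coordinate is the outer formula
    have hx : D / 4 < |p.1| := by have := not_lt.mp hcore; linarith
    have hev : (fun q : ℝ × ℝ => compCoord D q.1 q.2) =ᶠ[𝓝 p] compCoordOut D := by
      have ho : IsOpen ({q : ℝ × ℝ | D / 4 < |q.1|} ∩ compDom D) :=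
        (isOpen_lt continuous_const (continuous_abs.comp continuous_fst)).inter (isOpen_compDom D)
      filter_upwards [ho.mem_nhds ⟨hx, hp⟩] with q hq using compCoord_eq_out hD hq.1 hq.2
    refine (compCoordOut_contDiffAt hD ?_ (abscissa_ne_zero hD hx hs)).congr_of_eventuallyEq hev
    intro h; rw [h, abs_zero] at hx; linarith

/-- **The compensated coordinate is smooth on the band** (`ContDiffOn` form). [folklore] -/
theorem compCoord_contDiffOn {D : ℝ} (hD : 0 < D) {n : ℕ∞} :
    ContDiffOn ℝ n (fun q : ℝ × ℝ => compCoord D q.1 q.2) (compDom D) := fun _ hp =>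
  (compCoord_contDiffAt hD hp).contDiffWithinAt

/-! ### The first-order equation `(1 + λ' s) Fₛ - λ Fₓ = 1` on the band -/

/-- Derivative of the core formula: `D(compCoordCore)(x,s) = (1 - s/(2D))⁻¹ • snd`. [folklore] -/
theorem hasFDerivAt_compCoordCore {D : ℝ} (hD : 0 < D) {p : ℝ × ℝ} (hp : p.2 < 2 * D) :
    HasFDerivAt (compCoordCore D) ((1 - p.2 / (2 * D))⁻¹ • ContinuousLinearMap.snd ℝ ℝ ℝ) p := by
  have hpos : 1 - p.2 / (2 * D) ≠ 0 := by
    have : p.2 / (2 * D) < 1 := by rw [div_lt_one (by positivity)]; linarith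
    linarith
  have h1 : HasFDerivAt (fun q : ℝ × ℝ => 1 - q.2 / (2 * D))
      (-((1 / (2 * D)) • ContinuousLinearMap.snd ℝ ℝ ℝ)) p := by
    have h := ((hasFDerivAt_snd (𝕜 := ℝ) (E := ℝ) (F := ℝ) (p := p)).mul_const (1 / (2 * D))).const_sub 1
    have e : (fun q : ℝ × ℝ => 1 - q.2 / (2 * D)) = fun q : ℝ × ℝ => 1 - q.2 * (1 / (2 * D)) := by
      funext q; ring
    rw [e]
    exact h
  have h2 := (h1.log hpos).const_mul (-(2 * D))
  have e2 : compCoordCore D = fun q : ℝ × ℝ => -(2 * D) * Real.log (1 - q.2 / (2 * D)) := rfl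
  rw [e2]
  refine h2.congr_fderiv (ContinuousLinearMap.ext fun q => ?_)
  simp
  field_simp

/-- Derivative of the outer formula where `x ≠ 0`, `x + λ(x) s ≠ 0`:
`D(compCoordOut)(x,s) = (λ⁻¹(w)(1 + λ'(x) s) - λ⁻¹(x)) • fst + (λ⁻¹(w) λ(x)) • snd`, `w = x + λ(x) s`,
`λ' = deriv λ`. [folklore] -/
theorem hasFDerivAt_compCoordOut {D : ℝ} (hD : 0 < D) {p : ℝ × ℝ} (h0 : p.1 ≠ 0)
    (hw : p.1 + shearProfile D p.1 * p.2 ≠ 0) :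
    HasFDerivAt (compCoordOut D)
      ((shearRecip D (p.1 + shearProfile D p.1 * p.2) * (1 + deriv (shearProfile D) p.1 * p.2) -
            shearRecip D p.1) • ContinuousLinearMap.fst ℝ ℝ ℝ +
        (shearRecip D (p.1 + shearProfile D p.1 * p.2) * shearProfile D p.1) • ContinuousLinearMap.snd ℝ ℝ ℝ) p := by
  have hlam : HasDerivAt (shearProfile D) (deriv (shearProfile D) p.1) p.1 :=
    ((shearProfile_contDiff D (n := 1)).differentiable one_ne_zero p.1).hasDerivAt
  -- the sheared abscissa `q ↦ q.1 + λ(q.1) q.2`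
  have hwf : HasFDerivAt (fun q : ℝ × ℝ => q.1 + shearProfile D q.1 * q.2)
      ((1 + deriv (shearProfile D) p.1 * p.2) • ContinuousLinearMap.fst ℝ ℝ ℝ +
        shearProfile D p.1 • ContinuousLinearMap.snd ℝ ℝ ℝ) p := by
    have hl : HasFDerivAt (fun q : ℝ × ℝ => shearProfile D q.1)
        (deriv (shearProfile D) p.1 • ContinuousLinearMap.fst ℝ ℝ ℝ) p := by
      have h := hlam.comp_hasFDerivAt p (hasFDerivAt_fst (𝕜 := ℝ) (E := ℝ) (F := ℝ) (p := p))
      refine h.congr_fderiv (ContinuousLinearMap.ext fun q => ?_)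
      simp [mul_comm]
    have h := (hasFDerivAt_fst (𝕜 := ℝ) (E := ℝ) (F := ℝ) (p := p)).add (hl.mul (hasFDerivAt_snd (𝕜 := ℝ) (E := ℝ) (F := ℝ) (p := p)))
    refine h.congr_fderiv (ContinuousLinearMap.ext fun q => ?_)
    simp
    ring
  have hPw := (hasDerivAt_shearPrim hD hw).comp_hasFDerivAt p hwf
  have hPx := (hasDerivAt_shearPrim hD h0).comp_hasFDerivAt p (hasFDerivAt_fst (𝕜 := ℝ) (E := ℝ) (F := ℝ) (p := p))
  refine (hPw.sub hPx).congr_fderiv (ContinuousLinearMap.ext fun q => ?_)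
  simp
  ring

/-- On the open core `|x| < 3D/4` the derivative of the profile is `-1/(2D)`. [folklore] -/
theorem deriv_shearProfile_of_core {D x : ℝ} (hD : 0 < D) (hx : |x| < 3 * D / 4) :
    deriv (shearProfile D) x = -(1 / (2 * D)) := by
  have hev : shearProfile D =ᶠ[𝓝 x] fun y => -(y / (2 * D)) := by
    have ho : IsOpen {y : ℝ | |y| < 3 * D / 4} := isOpen_lt continuous_abs continuous_const
    filter_upwards [ho.mem_nhds hx] with y hy using shearProfile_of_abs_le hD hy.le
  rw [hev.deriv_eq, deriv.fun_neg, deriv_div_const, deriv_id'']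

/-- **The compensated coordinate solves `(1 + λ'(x) s) Fₛ - λ(x) Fₓ = 1` on the band `|s| < D/2`.**
[folklore] -/
theorem compCoord_pde {D : ℝ} (hD : 0 < D) {p : ℝ × ℝ} (hp : p ∈ compDom D) :
    (1 + deriv (shearProfile D) p.1 * p.2) * fderiv ℝ (fun q : ℝ × ℝ => compCoord D q.1 q.2) p (0, 1) -
      shearProfile D p.1 * fderiv ℝ (fun q : ℝ × ℝ => compCoord D q.1 q.2) p (1, 0) = 1 := by
  have hs : |p.2| < D / 2 := hp
  by_cases hcore : |p.1| < D / 2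
  · have hev : (fun q : ℝ × ℝ => compCoord D q.1 q.2) =ᶠ[𝓝 p] compCoordCore D := by
      have ho : IsOpen {q : ℝ × ℝ | |q.1| < D / 2} := isOpen_lt (continuous_abs.comp continuous_fst) continuous_const
      filter_upwards [ho.mem_nhds hcore] with q hq using compCoord_of_core hq
    have hs2 : p.2 < 2 * D := by rw [abs_lt] at hs; linarith
    rw [hev.fderiv_eq, (hasFDerivAt_compCoordCore hD hs2).fderiv, deriv_shearProfile_of_core hD (by linarith)]
    have hpos : 2 * D - p.2 ≠ 0 := by linarith
    have e : 1 - p.2 / (2 * D) = (2 * D - p.2) / (2 * D) := by field_simp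
    simp only [_root_.smul_apply, ContinuousLinearMap.coe_snd', smul_eq_mul, mul_one,
      mul_zero, sub_zero, e]
    field_simp
    ring
  · have hx : D / 4 < |p.1| := by have := not_lt.mp hcore; linarith
    have h0 : p.1 ≠ 0 := by intro h; rw [h, abs_zero] at hx; linarith
    have hw := abscissa_ne_zero hD hx hs
    have hev : (fun q : ℝ × ℝ => compCoord D q.1 q.2) =ᶠ[𝓝 p] compCoordOut D := by
      have ho : IsOpen ({q : ℝ × ℝ | D / 4 < |q.1|} ∩ compDom D) :=
        (isOpen_lt continuous_const (continuous_abs.comp continuous_fst)).inter (isOpen_compDom D)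
      filter_upwards [ho.mem_nhds ⟨hx, hp⟩] with q hq using compCoord_eq_out hD hq.1 hq.2
    rw [hev.fderiv_eq, (hasFDerivAt_compCoordOut hD h0 hw).fderiv]
    have hl0 : shearProfile D p.1 ≠ 0 := shearProfile_ne_zero hD h0
    have hlw : shearProfile D (p.1 + shearProfile D p.1 * p.2) ≠ 0 := shearProfile_ne_zero hD hw
    simp only [_root_.add_apply, _root_.smul_apply, ContinuousLinearMap.coe_fst', ContinuousLinearMap.coe_snd',
      smul_eq_mul, mul_one, mul_zero, add_zero, zero_add, shearRecip_apply]
    field_simp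
    ring

/-! ### The arms: `F(x, s) = s` where the profile is constant along `[x, x + λ s]` -/

/-- **On the right arm the coordinate is the offset**: for `x ≥ 5D/4` and `|s| < D/2`,
`F(x, s) = s` (the profile is `-1/2` on `[x - D/4, ∞)`). [folklore] -/
theorem compCoord_of_ge {D x s : ℝ} (hD : 0 < D) (hx : 5 * D / 4 ≤ x) (hs : |s| < D / 2) : compCoord D x s = s := by
  have hxabs : D / 4 < |x| := by rw [abs_of_pos (by linarith)]; linarith
  rw [compCoord_eq_out hD hxabs hs, compCoordOut]
  simp only
  rw [shearProfile_of_ge hD (by linarith)]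
  have hx0 : 0 < x := by linarith
  have hw0 : 0 < x + -(1 / 2) * s := by rw [abs_lt] at hs; linarith
  rw [shearPrim_sub_of_pos hD hx0 hw0]
  have hcong : ∫ r in x..(x + -(1 / 2) * s), shearRecip D r = ∫ r in x..(x + -(1 / 2) * s), (-2 : ℝ) := by
    refine intervalIntegral.integral_congr fun r hr => ?_
    have hr' : D ≤ r := by
      rw [abs_lt] at hs
      rcases Set.mem_uIcc.mp hr with ⟨h1, _⟩ | ⟨h1, _⟩ <;> linarith
    rw [shearRecip_apply, shearProfile_of_ge hD hr']; norm_num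
  rw [hcong, intervalIntegral.integral_const]
  simp only [smul_eq_mul]
  ring

/-- **On the left arm the coordinate is the offset**: for `x ≤ -5D/4` and `|s| < D/2`,
`F(x, s) = s`. [folklore] -/
theorem compCoord_of_le {D x s : ℝ} (hD : 0 < D) (hx : x ≤ -(5 * D / 4)) (hs : |s| < D / 2) : compCoord D x s = s := by
  have hxabs : D / 4 < |x| := by rw [abs_of_neg (by linarith)]; linarith
  rw [compCoord_eq_out hD hxabs hs, compCoordOut]
  simp only
  rw [shearProfile_of_le hD (by linarith)]
  have hx0 : x < 0 := by linarith
  have hw0 : x + 1 / 2 * s < 0 := by rw [abs_lt] at hs; linarith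
  rw [shearPrim_sub_of_neg hD hx0 hw0]
  have hcong : ∫ r in x..(x + 1 / 2 * s), shearRecip D r = ∫ r in x..(x + 1 / 2 * s), (2 : ℝ) := by
    refine intervalIntegral.integral_congr fun r hr => ?_
    have hr' : r ≤ -D := by
      rw [abs_lt] at hs
      rcases Set.mem_uIcc.mp hr with ⟨_, h2⟩ | ⟨_, h2⟩ <;> linarith
    rw [shearRecip_apply, shearProfile_of_le hD hr']; norm_num
  rw [hcong, intervalIntegral.integral_const]
  simp only [smul_eq_mul]
  ring

end PlanarKinematics

end Literature.Analysis.FluidPDE
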